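import Summits.NavierStokesRegularity.NavierStokesRegularity.Theses.AxisymmetricExtremality
import Summits.NavierStokesRegularity.NavierStokesRegularity.Theorems.AxisymmetricExtremalityPFoldToAxisymmetric
import Summits.NavierStokesRegularity.NavierStokesRegularity.Theorems.AxisymmetricExtremalityAxisymmetricKatoGlobalStubKatoAxisymSingularPoint
import Summits.NavierStokesRegularity.NavierStokesRegularity.Theorems.AxisymmetricExtremalityAxisymmetricKatoGlobalStubKatoLocalEnergyNearTop
import Summits.NavierStokesRegularity.NavierStokesRegularity.Theorems.AxisymmetricExtremalityAxisymmetricKatoGlobalStubOffAxisBoundedOfLocalEnergy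
import Literature.Analysis.FluidPDE.SelfSimilar
import Literature.Analysis.FluidPDE.KNSSAxisymmetricNoSwirlHolds
import Literature.Analysis.FluidPDE.KNSSNoAxisymmetricTypeIHolds
import Literature.Analysis.FluidPDE.OzanskiPalasek2022AxisymWeakL3Quantitative
import HarnessLib

/-!
# Strategist census sketch (family `s`, seat s20-g18) — crux `AxisymmetricExtremality.AxisymmetricKatoGlobal`
# (stmt-NavierStokesRegularity-15453)

Typed companions of `STRATEGY-CENSUS-s20.md` (independent second census).  Nothing here is a
registered line: the file records, kernel-checked where that is cheap,

* **§1 weakest replacement.**  `ThresholdInstance` (W₀: no axisymmetric Rusin–Šverák MINIMAL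
  blow-up datum) is implied by the crux (`thresholdInstance_of_crux`), suffices for the route's
  deciding theorem together with the other open crux (`navierStokesRegularity_of_threshold`), and is
  equivalent to its "large-fold" form `LargeFoldInstance` (`largeFoldInstance_iff_thresholdInstance`,
  via the PROVED crux `PFoldToAxisymmetric`).  So W₀ is the canonical weakest intermediate the
  summit statement allows in this route; the census explains why no tool exploits minimality.
* **§2 decomposition.**  The ancient-solution / Liouville split `AxisTypeIIAncientLimit` (L1) ∧
  `AxisymBoundedSwirlLiouville` (L2) with the kernel-checked composition
  `AxisymmetricKatoGlobal_of_liouvilleSplit : L1 → L2 → AxisymmetricKatoGlobal` (crux BY NAME, using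
  the landed stubs 1, K, 2b' of line `registered`).  The census explains why L1 has no teeth (the
  velocity-normalised zoom at a Type II axis point may converge to the constant axial drift
  `b(s) e_z`, which no Liouville theorem excludes; the vorticity-normalised zoom admits the Burgers
  vortex).
* **§3 strengthening.**  `UniformWeakL3Bound` (S⁺: an a-priori weak-`L³` bound for axisymmetric
  Kato solutions), the form in which Ożański–Palasek 2022 (`ozanskiPalasek2022_axisym_weakL3_quantitative`,
  tree fact) would close the crux; stated only.
* **§4 negation.**  The typed obstruction is the tree theorem `knss_no_axisymmetric_typeI_holds`
  (referenced by `example`).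
-/

noncomputable section

open Set MeasureTheory Filter Topology Function Metric
open scoped ENNReal NNReal
open Literature.Analysis.FluidPDE Literature.Analysis.FunctionSpaces
open Summit.NavierStokesRegularity.NavierStokesRegularity.Theorems.AxisymmetricKatoGlobal
open Summit.NavierStokesRegularity.NavierStokesRegularity.Theses.AxisymmetricExtremality

namespace Summit.NavierStokesRegularity.NavierStokesRegularity.Cruxes.AxisymmetricKatoGlobal.StrategistS20g18

set_option linter.unusedVariables false
set_option linter.dupNamespace false

local notation "ℝ³" => EuclideanSpace ℝ (Fin 3)
local notation "ℂ³" => EuclideanSpace ℂ (Fin 3)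

/-! ## §1  The weakest replacement of the crux read off `closes` -/

/-- **W₀ — threshold instance.**  For every `ν > 0` no Rusin–Šverák minimal blow-up datum is
axisymmetric (rotation-equivariance written out exactly as in the crux). [folklore] -/
def ThresholdInstance : Prop :=
  ∀ ν : ℝ, 0 < ν → ¬ ∃ (u₀ : ℝ³ → ℝ³) (g : HomSobolev ℝ³ ℂ³ (1 / 2 : ℝ)),
    IsMinimalBlowupDatum ν u₀ g ∧
      ∀ (θ : ℝ) (x : ℝ³), u₀ (WithLp.toLp 2 ![Real.cos θ * x 0 - Real.sin θ * x 1,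
        Real.sin θ * x 0 + Real.cos θ * x 1, x 2]) =
        WithLp.toLp 2 ![Real.cos θ * u₀ x 0 - Real.sin θ * u₀ x 1,
          Real.sin θ * u₀ x 0 + Real.cos θ * u₀ x 1, u₀ x 2]

/-- **W_∞ — large-fold instance.**  For every `ν > 0` there is an order `N` such that no minimal
blow-up datum is `p`-fold rotationally symmetric with `N ≤ p`, `2 ≤ p` (the literal negation of the
conclusion of the open crux `MinimalDatumPFold`). [folklore] -/
def LargeFoldInstance : Prop :=
  ∀ ν : ℝ, 0 < ν → ∃ N : ℕ, ∀ p : ℕ, N ≤ p → 2 ≤ p → ¬ ∃ (u₀ : ℝ³ → ℝ³)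
    (g : HomSobolev ℝ³ ℂ³ (1 / 2 : ℝ)), IsMinimalBlowupDatum ν u₀ g ∧
      ∀ x : ℝ³, u₀ (WithLp.toLp 2 ![Real.cos (2 * Real.pi / p) * x 0 - Real.sin (2 * Real.pi / p) * x 1,
        Real.sin (2 * Real.pi / p) * x 0 + Real.cos (2 * Real.pi / p) * x 1, x 2]) =
        WithLp.toLp 2 ![Real.cos (2 * Real.pi / p) * u₀ x 0 - Real.sin (2 * Real.pi / p) * u₀ x 1,
          Real.sin (2 * Real.pi / p) * u₀ x 0 + Real.cos (2 * Real.pi / p) * u₀ x 1, u₀ x 2]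

/-- The crux implies its threshold instance (the only use `closes` makes of it). [folklore] -/
theorem thresholdInstance_of_crux (h : AxisymmetricKatoGlobal) : ThresholdInstance := by
  intro ν hν ⟨u₀, g, hmin, hax⟩
  obtain ⟨hL3, hrep, hdiv, -, hnot⟩ := hmin
  exact hnot (h ν hν u₀ g hL3 hrep hdiv hax)

/-- **W₀ replaces the crux in the deciding theorem**: `MinimalDatumPFold → W₀ → Clay (A)`, by the
same pure logic as `closes` and the PROVED crux `PFoldToAxisymmetric`. [folklore] -/
theorem navierStokesRegularity_of_threshold (h₂ : MinimalDatumPFold) (h₀ : ThresholdInstance) :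
    NavierStokesRegularity := by
  show Literature.NS.NavierStokesExistenceSmoothR3
  intro ν hν u₀ hsm hdiv hdec
  by_contra hno
  exact h₀ ν hν (Theorems.axisymmetricExtremality_pFoldToAxisymmetric_proof ν hν
    (h₂ ν hν ⟨u₀, hsm, hdiv, hdec, hno⟩))

/-- **W_∞ ↔ W₀** given the tree: an axisymmetric datum is `p`-fold for every `p` (so W_∞ ⇒ W₀ by
instantiating `θ = 2π/p`), and a sequence of `p_k`-fold minimal data with `p_k → ∞` yields an
axisymmetric minimal datum (`PFoldToAxisymmetric`, proved: compactness of `M` modulo `Sim`), so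
W₀ ⇒ W_∞.  Hence W₀ is, up to this equivalence, THE weakest statement that can stand in for the
crux in this route. [folklore] -/
theorem largeFoldInstance_iff_thresholdInstance : LargeFoldInstance ↔ ThresholdInstance := by
  constructor
  · intro h ν hν ⟨u₀, g, hmin, hax⟩
    obtain ⟨N, hN⟩ := h ν hν
    exact hN (max N 2) (le_max_left _ _) (le_max_right _ _) ⟨u₀, g, hmin, fun x => hax _ x⟩
  · intro h ν hν
    by_contra hc
    push Not at hc
    apply h ν hν
    have hfold : ∀ N : ℕ, ∃ p : ℕ, N ≤ p ∧ 2 ≤ p ∧ ∃ (u₀ : ℝ³ → ℝ³)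
        (g : HomSobolev ℝ³ ℂ³ (1 / 2 : ℝ)), IsMinimalBlowupDatum ν u₀ g ∧
        ∀ x : ℝ³, u₀ (WithLp.toLp 2 ![Real.cos (2 * Real.pi / p) * x 0 - Real.sin (2 * Real.pi / p) * x 1,
          Real.sin (2 * Real.pi / p) * x 0 + Real.cos (2 * Real.pi / p) * x 1, x 2]) =
          WithLp.toLp 2 ![Real.cos (2 * Real.pi / p) * u₀ x 0 - Real.sin (2 * Real.pi / p) * u₀ x 1,
            Real.sin (2 * Real.pi / p) * u₀ x 0 + Real.cos (2 * Real.pi / p) * u₀ x 1, u₀ x 2] := by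
      intro N
      obtain ⟨p, hNp, h2p, hex⟩ := hc N
      exact ⟨p, hNp, h2p, hex⟩
    exact Theorems.axisymmetricExtremality_pFoldToAxisymmetric_proof ν hν hfold

/-! ## §2  The ancient-solution / Liouville decomposition (typed; composition kernel-checked) -/

/-- **L1 — non-constant ancient limit at an axis singular point.**  For an axisymmetric Kato
solution on `[0,T)` (datum represented in `Ḣ^{1/2}`, jointly smooth inside) and an axis point `x₀`
at which `u` is NOT bounded near the final time, some blow-up zoom converges to a BOUNDED ancient
mild solution `U` (same viscosity) with measurable axisymmetric slices, bounded swirl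
`Γ_U = swirl (U s)`, which is NOT slice-wise a constant multiple of `e_z`.  (KNSS 2009 §1 zoom at
the velocity scale gives everything except the last clause; see the census for why the last
clause is the whole difficulty at a Type II point.) [cite: KochNadirashviliSereginSverak2009, §1] -/
def AxisTypeIIAncientLimit : Prop :=
  ∀ ν : ℝ, 0 < ν → ∀ T : ℝ, 0 < T → ∀ (u₀ : ℝ³ → ℝ³) (g : HomSobolev ℝ³ ℂ³ (1 / 2 : ℝ))
    (u : ℝ → ℝ³ → ℝ³), g.Represents (Literature.Analysis.FunctionSpaces.EuclideanSpace.complexify ∘ u₀) →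
    IsKatoSolutionOn T ν u₀ u → ContDiffOn ℝ (⊤ : ℕ∞) (uncurry u) (Ioo 0 T ×ˢ univ) →
    (∀ t ∈ Ioo 0 T, IsAxisymmetric (u t)) → ∀ x₀ : ℝ³, cylRadius x₀ = 0 → ¬ IsBoundedNearTop u T x₀ →
    ∃ U : ℝ → ℝ³ → ℝ³, IsBoundedAncientMildSolution ν U ∧
      (∀ s < 0, AEStronglyMeasurable (U s) volume) ∧ (∀ s < 0, IsAxisymmetric (U s)) ∧
      (∃ C : ℝ, ∀ s < 0, ∀ y : ℝ³, |swirl (U s) y| ≤ C) ∧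
      ¬ ∀ s < 0, ∃ β : ℝ, U s =ᵐ[volume] fun _ => β • eZ

/-- **L2 — the axisymmetric Liouville conjecture with bounded swirl** (Koch–Nadirashvili–Seregin–
Šverák 2009, §1 and Thm 5.2/5.3: proved for NO swirl (`knss_axisymmetric_no_swirl_holds`, tree) and
under `|u| ≤ C/r` (Thm 5.3, tree); OPEN in general): a bounded ancient mild solution with measurable
axisymmetric slices and bounded swirl is slice-wise a constant multiple of `e_z`.
[cite: KochNadirashviliSereginSverak2009, §1 (Liouville conjecture, axisymmetric case)] -/
def AxisymBoundedSwirlLiouville : Prop :=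
  ∀ ν : ℝ, 0 < ν → ∀ U : ℝ → ℝ³ → ℝ³, IsBoundedAncientMildSolution ν U →
    (∀ s < 0, AEStronglyMeasurable (U s) volume) → (∀ s < 0, IsAxisymmetric (U s)) →
    (∃ C : ℝ, ∀ s < 0, ∀ y : ℝ³, |swirl (U s) y| ≤ C) →
    ∀ s < 0, ∃ β : ℝ, U s =ᵐ[volume] fun _ => β • eZ

/-- A pointwise bound on the backward cylinder makes the `L^∞` norm on `parabolicCylinder r (T, x_*)`
finite (support lemma, as in line `registered`). [folklore] -/
theorem eLpNorm_parabolicCylinder_lt_top_of_bound {u : ℝ → ℝ³ → ℝ³} {T r K : ℝ} {xs : ℝ³}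
    (h : ∀ t ∈ Ioo (T - r ^ 2) T, ∀ x ∈ ball xs r, ‖u t x‖ ≤ K) :
    eLpNorm (uncurry u) ∞ (volume.restrict (parabolicCylinder r (T, xs))) < ∞ := by
  have hmeas : MeasurableSet (parabolicCylinder r ((T, xs) : ℝ × ℝ³)) := by
    unfold parabolicCylinder
    exact measurableSet_Ioo.prod measurableSet_ball
  have hbound : ∀ᵐ z ∂(volume.restrict (parabolicCylinder r ((T, xs) : ℝ × ℝ³))), ‖uncurry u z‖ ≤ K := by
    filter_upwards [ae_restrict_mem hmeas] with z hz
    obtain ⟨ht, hx⟩ := mem_prod.1 hz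
    exact h z.1 ht z.2 hx
  rw [eLpNorm_exponent_top]
  exact (eLpNormEssSup_le_of_ae_bound hbound).trans_lt ENNReal.ofReal_lt_top

/-- **Composition of the split (kernel-checked): `L1 → L2 → crux` BY NAME**, through the landed
stubs 1 (`Registered.stub_katoAxisymSingularPoint`), K (`Registered.stub_katoLocalEnergyNearTop`) and
2b' (`Registered.stub_offAxisBounded_of_localEnergy`) of line `registered`. [folklore] -/
theorem AxisymmetricKatoGlobal_of_liouvilleSplit (hL1 : AxisTypeIIAncientLimit)
    (hL2 : AxisymBoundedSwirlLiouville) : AxisymmetricKatoGlobal := by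
  intro ν hν u₀ g hL3 hrep hdiv hax
  have hax' : IsAxisymmetric u₀ := fun θ x => hax θ x
  by_contra hng
  obtain ⟨T, hT, xs, u, hK, hsm, haxi, hsing⟩ :=
    Registered.stub_katoAxisymSingularPoint ν hν u₀ hL3 hdiv hax' hng
  obtain ⟨p, hpax, hsw, hloc⟩ := Registered.stub_katoLocalEnergyNearTop ν hν T hT u₀ u hK hsm haxi
  have hbdd : IsBoundedNearTop u T xs := by
    by_cases h0 : cylRadius xs = 0
    · by_contra hnb
      obtain ⟨U, hU, hmeas, haxU, hΓ, hnc⟩ := hL1 ν hν T hT u₀ g u hrep hK hsm haxi xs h0 hnb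
      exact hnc (hL2 ν hν U hU hmeas haxU hΓ)
    · exact Registered.stub_offAxisBounded_of_localEnergy ν hν T hT u p hsm haxi hsw hloc xs h0
  obtain ⟨r, hr, K, hbd⟩ := hbdd
  exact absurd (hsing r hr) (eLpNorm_parabolicCylinder_lt_top_of_bound hbd).ne

/-- Both pieces are consequences of the crux only through L1's vacuity: the crux makes L1's
hypothesis `¬ IsBoundedNearTop` unreachable?  No — L1 quantifies over Kato solutions on `[0,T)`
that need not be maximal, so the crux does NOT trivially give L1; and L2 does not mention Kato
solutions at all.  Neither piece is known to imply the crux alone: L2 without L1 is KNSS's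
programme, which needs a Type I rate to make the ancient limit non-constant
(`knss_no_axisymmetric_typeI_holds`, referenced below). [folklore] -/
example : knss_no_axisymmetric_typeI := knss_no_axisymmetric_typeI_holds

/-- The swirl-free case of L2 is a theorem of the tree (KNSS 2009 Thm 5.2). [folklore] -/
example : knss_axisymmetric_no_swirl := knss_axisymmetric_no_swirl_holds

/-! ## §3  Strengthening S⁺ (stated only) -/

/-- **S⁺ — uniform a-priori weak-`L³` bound in the axisymmetric Kato class.**  There is a function
`F` such that every axisymmetric Kato solution on `[0,T)` from a datum represented by `g ∈ Ḣ^{1/2}`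
obeys `‖u(t)‖_{L^{3,∞}}³ ≤ F ‖g‖` for `0 < t < T`.  With Ożański–Palasek 2022 Thm 1.1 (tree fact
`ozanskiPalasek2022_axisym_weakL3_quantitative`) this bounds `u` up to `T`, hence closes the crux;
it is HARDER than the crux (nothing in print bounds a critical norm a priori; Seregin 2012 /
Ożański–Palasek Cor. 1.2 say the norm must blow up at a singularity). [cite: OzanskiPalasek2022, Thm. 1.1] -/
def UniformWeakL3Bound : Prop :=
  ∃ F : ℝ≥0∞ → ℝ≥0∞, ∀ ν : ℝ, 0 < ν → ∀ T : ℝ, 0 < T → ∀ (u₀ : ℝ³ → ℝ³)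
    (g : HomSobolev ℝ³ ℂ³ (1 / 2 : ℝ)) (u : ℝ → ℝ³ → ℝ³),
    g.Represents (Literature.Analysis.FunctionSpaces.EuclideanSpace.complexify ∘ u₀) →
    IsKatoSolutionOn T ν u₀ u → (∀ t ∈ Ioo 0 T, IsAxisymmetric (u t)) →
    ∀ t ∈ Ioo 0 T, Literature.Analysis.FunctionSpaces.eWeakLpPow (u t) 3 volume ≤ F ‖g‖ₑ

/-- The printed tool that would consume S⁺ (tree fact, undischarged named `Prop`). [folklore] -/
example : Prop := ozanskiPalasek2022_axisym_weakL3_quantitative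

end Summit.NavierStokesRegularity.NavierStokesRegularity.Cruxes.AxisymmetricKatoGlobal.StrategistS20g18

end
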